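import Summits.CriticalPhenomena.SAWScalingLimit.Theorems.SAWRenewalTightnessKestenIdentityRenewal
import Mathlib.Analysis.SpecialFunctions.Exp

/-!
# Stub S1 `stub_kestenTilt` of the line `subcritical-renewal-floor` (crux `TubeLowerBound`,
stmt-CriticalPhenomena-4730), part I: cuts of bridge words and truncated generating functions

Support file (step-word model of `SAWWords.lean` / `SAWWordBridges.lean`) for
`SAWRenewalTightnessTubeLowerBoundKestenTilt.lean` (exactly tilted Kesten pairs below `x_c`,
Madras–Slade 1993, §4.2, (4.2.11)–(4.2.15)).  Contents:

* `exists_xAt_eq` — the discrete intermediate value property of the first coordinate;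
* `exists_pos_append_bridge` — LAST-EXIT CUT: a bridge of span `≥ L ≥ 0`, cut at its last visit to the
  line `x = L`, is a half-space word (`0 < x(i)` for `i ≥ 1`) ending on that line followed by a bridge;
* `exists_bridge_prefix_of_pos` — CUT AT A MAXIMUM: a half-space word, cut at a time where `x` is
  maximal, is a bridge (of span `≥` the final level) followed by a self-avoiding word;
* `sum_le_mul_sum_of_split` — the weighted-sum inequality behind every such decomposition;
* the truncated generating functions, always WRITTEN OUT as explicit finite sums (no definitions):
  over the self-avoiding words `W_N = (Finset.range (N + 1)).biUnion sawWords` of length `≤ N`, with the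
  tilted weight `z^{|w|} e^{m·span(w)} = z ^ w.length * Real.exp (m * (xEnd w : ℝ))` (multiplicative,
  `tiltWt_append`): `Φ_N(z, m)` = the tilted sum over `W_N.filter IsIrrBridge` (lemma prefix `gfIrr`),
  `B_N(z, m)` = over `W_N.filter IsBridgeW` (`gfBr`), `B_N^{≥ L}(z, m)` = over the bridge words with
  `L ≤ xEnd w` (`gfBrGe`), `H_N(z, L)` = the UNTILTED sum `Σ z^{|w|}` over the half-space words
  (`0 < xAt w i` for `1 ≤ i ≤ |w|`) with `xEnd w = L` (`gfPos`), `χ_N(z) = Σ_{w ∈ W_N} z^{|w|}` (`gfAll`);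
  and their monotonicity / continuity in `N` and `z`.

References: N. Madras, G. Slade, *The Self-Avoiding Walk* (1993), §3.1 (proof of Prop. 3.1.5), §4.1
((4.1.12)–(4.1.13)), §4.2 ((4.2.11)–(4.2.12)).
-/

noncomputable section

namespace Summit.CriticalPhenomena.SAWScalingLimit.Theorems.TubeLowerBound.SubcriticalRenewalFloor

open scoped BigOperators Classical
open Literature.Probability.LatticeModels
open Literature.Probability.RandomPlanarGeometry Literature.Probability.RandomPlanarGeometry.SAW

namespace KestenTilt

open Finset Filter Topology

/-! ### Words: first-coordinate bookkeeping -/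

/-- `x(i) ≤ i`: the first coordinate moves by at most one per step. [folklore] -/
theorem xAt_le_nat (w : List Step) : ∀ i : ℕ, xAt w i ≤ (i : ℤ)
  | 0 => by simp
  | i + 1 => by
    have h1 := xAt_le_nat w i
    have h2 := abs_xAt_succ_sub_le w i
    rw [abs_le] at h2
    push_cast
    omega

/-- The span of a word is at most its length. [folklore] -/
theorem xEnd_le_length (w : List Step) : xEnd w ≤ (w.length : ℤ) := xAt_le_nat w w.length

/-- **Discrete intermediate value property** of the first coordinate: if `x(i) ≤ L ≤ x(j)`, `i ≤ j`,
then `x(k) = L` for some `i ≤ k ≤ j` (steps change `x` by at most one). [folklore] -/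
theorem exists_xAt_eq (w : List Step) (L : ℤ) (i : ℕ) (hi : xAt w i ≤ L) :
    ∀ j : ℕ, i ≤ j → L ≤ xAt w j → ∃ k, i ≤ k ∧ k ≤ j ∧ xAt w k = L := by
  intro j
  induction j with
  | zero =>
    intro hij hL
    obtain rfl : i = 0 := Nat.le_zero.1 hij
    exact ⟨0, le_rfl, le_rfl, le_antisymm hi hL⟩
  | succ j ih =>
    intro hij hL
    rcases Nat.eq_or_lt_of_le hij with h | h
    · subst h
      exact ⟨j + 1, le_rfl, le_rfl, le_antisymm hi hL⟩
    · by_cases hj : L ≤ xAt w j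
      · obtain ⟨k, hk1, hk2, hk3⟩ := ih (by omega) hj
        exact ⟨k, hk1, by omega, hk3⟩
      · push Not at hj
        have h2 := abs_xAt_succ_sub_le w j
        rw [abs_le] at h2
        exact ⟨j + 1, hij, le_rfl, by omega⟩

/-- A bridge is a HALF-SPACE WORD: `0 < x(i)` for `1 ≤ i ≤ |w|` (Madras–Slade's half-space walks, as
step words; this predicate is always written out in full below). [cite: MadrasSlade1993, Definition 1.2.4] -/
theorem isPos_of_bridge {w : List Step} (h : IsBridgeW w) :
    ∀ i, 1 ≤ i → i ≤ w.length → 0 < xAt w i := fun i h1 h2 =>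
  ((isBridgeW_iff w).1 h i h1 h2).1

/-! ### Two cuts -/

/-- **Last-exit cut.** A bridge `w` whose span is `≥ L ≥ 0`, cut at its LAST visit to the line
`x = L`, is a half-space word ending on that line followed by (a translate of) a bridge.
[cite: MadrasSlade1993, §4.1, proof of (4.1.12)] -/
theorem exists_pos_append_bridge {w : List Step} (hb : IsBridgeW w) {L : ℤ} (hL0 : 0 ≤ L)
    (hL : L ≤ xEnd w) :
    ∃ u v : List Step, u ++ v = w ∧ (∀ i, 1 ≤ i → i ≤ u.length → 0 < xAt u i) ∧ xEnd u = L ∧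
      IsBridgeW v := by
  -- the visits to the line `x = L`
  set T : Finset ℕ := (Finset.range (w.length + 1)).filter (fun j => xAt w j = L) with hT
  have hTne : T.Nonempty := by
    obtain ⟨k, -, hk, hkL⟩ := exists_xAt_eq w L 0 (by simpa using hL0) w.length (Nat.zero_le _) hL
    exact ⟨k, Finset.mem_filter.2 ⟨Finset.mem_range.2 (Nat.lt_succ_of_le hk), hkL⟩⟩
  set σ := T.max' hTne with hσ
  have hσT : σ ∈ T := Finset.max'_mem T hTne
  have hσlen : σ ≤ w.length := Nat.le_of_lt_succ (Finset.mem_range.1 (Finset.mem_filter.1 hσT).1)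
  have hσL : xAt w σ = L := (Finset.mem_filter.1 hσT).2
  have hmax : ∀ j, j ≤ w.length → xAt w j = L → j ≤ σ := fun j hj hjL =>
    Finset.le_max' T j (Finset.mem_filter.2 ⟨Finset.mem_range.2 (Nat.lt_succ_of_le hj), hjL⟩)
  have hlt : (w.take σ).length = σ := by rw [List.length_take, min_eq_left hσlen]
  refine ⟨w.take σ, w.drop σ, List.take_append_drop σ w, ?_, ?_, ?_⟩
  · intro i h1 h2
    rw [hlt] at h2
    rw [KestenIdentity.xAt_take w hσlen h2]
    exact ((isBridgeW_iff w).1 hb i h1 (h2.trans hσlen)).1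
  · rw [xEnd, hlt, KestenIdentity.xAt_take w hσlen le_rfl, hσL]
  · rw [isBridgeW_iff]
    intro k h1 h2
    rw [List.length_drop] at h2
    rw [xEnd, List.length_drop, KestenIdentity.xAt_drop w hσlen, KestenIdentity.xAt_drop w hσlen,
      show σ + (w.length - σ) = w.length by omega, hσL]
    refine ⟨?_, ?_⟩
    · by_contra hle
      push Not at hle
      obtain ⟨j, hj1, hj2, hj3⟩ :=
        exists_xAt_eq w L (σ + k) (by linarith) w.length (by omega) hL
      have := hmax j hj2 hj3
      omega
    · have := hb.xAt_le (σ + k)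
      rw [xEnd] at this
      linarith

/-- **Cut at a maximum.** A half-space word, cut at a time where its first coordinate is maximal, is a
bridge (of span that maximum, `≥` the final level) followed by a self-avoiding word.
[cite: MadrasSlade1993, §3.1, proof of Proposition 3.1.5] -/
theorem exists_bridge_prefix_of_pos {u : List Step} (hu : ∀ i, 1 ≤ i → i ≤ u.length → 0 < xAt u i) :
    ∃ p q : List Step, p ++ q = u ∧ IsBridgeW p ∧ xEnd u ≤ xEnd p := by
  obtain ⟨τ, hτ, hmax⟩ :=
    Finset.exists_max_image (Finset.range (u.length + 1)) (xAt u) ⟨0, by simp⟩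
  have hτlen : τ ≤ u.length := Nat.le_of_lt_succ (Finset.mem_range.1 hτ)
  have hmax' : ∀ i ≤ u.length, xAt u i ≤ xAt u τ := fun i hi =>
    hmax i (Finset.mem_range.2 (Nat.lt_succ_of_le hi))
  have hlt : (u.take τ).length = τ := by rw [List.length_take, min_eq_left hτlen]
  refine ⟨u.take τ, u.drop τ, List.take_append_drop τ u, ?_, ?_⟩
  · rw [isBridgeW_iff]
    intro i h1 h2
    rw [hlt] at h2
    rw [xEnd, hlt, KestenIdentity.xAt_take u hτlen h2, KestenIdentity.xAt_take u hτlen le_rfl]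
    exact ⟨hu i h1 (h2.trans hτlen), hmax' i (h2.trans hτlen)⟩
  · rw [xEnd, xEnd, hlt, KestenIdentity.xAt_take u hτlen le_rfl]
    exact hmax' u.length le_rfl

/-! ### A splitting inequality for weighted sums -/

/-- If every `u ∈ U` is a concatenation `p ++ q` with `p ∈ P`, `q ∈ Q` and `f u ≤ g p · h q`
(`g, h ≥ 0`), then `Σ_U f ≤ (Σ_P g)(Σ_Q h)`: the map `u ↦ (p, q)` is injective. [folklore] -/
theorem sum_le_mul_sum_of_split {U P Q : Finset (List Step)} {f g h : List Step → ℝ}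
    (hg : ∀ p ∈ P, 0 ≤ g p) (hh : ∀ q ∈ Q, 0 ≤ h q)
    (hsplit : ∀ u ∈ U, ∃ p ∈ P, ∃ q ∈ Q, p ++ q = u ∧ f u ≤ g p * h q) :
    ∑ u ∈ U, f u ≤ (∑ p ∈ P, g p) * ∑ q ∈ Q, h q := by
  choose! φ₁ hφ₁ φ₂ hφ₂ happ hle using hsplit
  have hinj : Set.InjOn (fun u => (φ₁ u, φ₂ u)) ↑U := by
    intro u hu u' hu' heq
    simp only [Prod.mk.injEq] at heq
    rw [← happ u hu, ← happ u' hu', heq.1, heq.2]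
  calc ∑ u ∈ U, f u
      ≤ ∑ u ∈ U, (fun pq : List Step × List Step => g pq.1 * h pq.2) (φ₁ u, φ₂ u) :=
        Finset.sum_le_sum fun u hu => hle u hu
    _ = ∑ pq ∈ U.image (fun u => (φ₁ u, φ₂ u)), g pq.1 * h pq.2 :=
        (Finset.sum_image (f := fun pq : List Step × List Step => g pq.1 * h pq.2) hinj).symm
    _ ≤ ∑ pq ∈ P ×ˢ Q, g pq.1 * h pq.2 := by
        refine Finset.sum_le_sum_of_subset_of_nonneg (Finset.image_subset_iff.2 fun u hu =>
          Finset.mem_product.2 ⟨hφ₁ u hu, hφ₂ u hu⟩) fun pq hpq _ => ?_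
        exact mul_nonneg (hg _ (Finset.mem_product.1 hpq).1) (hh _ (Finset.mem_product.1 hpq).2)
    _ = (∑ p ∈ P, g p) * ∑ q ∈ Q, h q := by rw [Finset.sum_product, Finset.sum_mul_sum]

/-- Differences of sums over nested finite sets are monotone in the summand. [folklore] -/
theorem sub_sum_mono {s t : Finset (List Step)} (hst : s ⊆ t) {f g : List Step → ℝ}
    (hfg : ∀ w, f w ≤ g w) : ∑ w ∈ t, f w - ∑ w ∈ s, f w ≤ ∑ w ∈ t, g w - ∑ w ∈ s, g w := by
  rw [← Finset.sum_sdiff hst, ← Finset.sum_sdiff hst (f := g), add_sub_cancel_right,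
    add_sub_cancel_right]
  exact Finset.sum_le_sum fun w _ => hfg w

/-! ### Words of bounded length and the tilted weight -/

/-- Membership in `W_N`. [folklore] -/
theorem mem_Wset {N : ℕ} {w : List Step} :
    w ∈ ((Finset.range (N + 1)).biUnion sawWords) ↔ w.length ≤ N ∧ IsSAW w := by
  simp only [Finset.mem_biUnion, Finset.mem_range, mem_sawWords]
  constructor
  · rintro ⟨n, hn, hl, hs⟩
    exact ⟨by omega, hs⟩
  · rintro ⟨hl, hs⟩
    exact ⟨w.length, by omega, rfl, hs⟩

/-- `W_N` is monotone in the cut-off `N`. [folklore] -/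
theorem Wset_mono {N N' : ℕ} (h : N ≤ N') :
    ((Finset.range (N + 1)).biUnion sawWords) ⊆ ((Finset.range (N' + 1)).biUnion sawWords) :=
  fun w hw => by
  rw [mem_Wset] at hw ⊢
  exact ⟨hw.1.trans h, hw.2⟩

/-- The tilted weight is non-negative for `z ≥ 0`. [folklore] -/
theorem tiltWt_nonneg {z : ℝ} (hz : 0 ≤ z) (m : ℝ) (w : List Step) :
    0 ≤ (z ^ w.length * Real.exp (m * (xEnd w : ℝ))) :=
  mul_nonneg (pow_nonneg hz _) (Real.exp_nonneg _)

/-- The tilted weight is multiplicative under concatenation (lengths and spans add). [folklore] -/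
theorem tiltWt_append (z m : ℝ) (u v : List Step) :
    (z ^ (u ++ v).length * Real.exp (m * (xEnd (u ++ v) : ℝ)))
        = (z ^ u.length * Real.exp (m * (xEnd u : ℝ)))
        * (z ^ v.length * Real.exp (m * (xEnd v : ℝ))) := by
  simp only [List.length_append, pow_add, xEnd_append, Int.cast_add, mul_add, Real.exp_add]
  ring

/-- The empty word has tilted weight `1`. [folklore] -/
theorem tiltWt_nil (z m : ℝ) : z ^ ([] : List Step).length * Real.exp (m * (xEnd [] : ℝ)) = 1 := by
  simp [xEnd]

/-- The tilted weight is monotone in `z ≥ 0`. [folklore] -/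
theorem tiltWt_mono {z z' : ℝ} (hz : 0 ≤ z) (hzz' : z ≤ z') (m : ℝ) (w : List Step) :
    (z ^ w.length * Real.exp (m * (xEnd w : ℝ))) ≤ (z' ^ w.length * Real.exp (m * (xEnd w : ℝ))) :=
  mul_le_mul_of_nonneg_right (pow_le_pow_left₀ hz hzz' _) (Real.exp_nonneg _)

/-! ### Elementary comparisons, monotonicity, continuity -/

/-- `Φ_N ≤ B_N` (irreducible bridges are bridges). [folklore] -/
theorem gfIrr_le_gfBr {z : ℝ} (hz : 0 ≤ z) (N : ℕ) (m : ℝ) :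
    (∑ w ∈ ((Finset.range (N + 1)).biUnion sawWords).filter (fun w => IsIrrBridge w),
    z ^ w.length * Real.exp (m * (xEnd w : ℝ)))
    ≤ (∑ w ∈ ((Finset.range (N + 1)).biUnion sawWords).filter (fun w => IsBridgeW w),
    z ^ w.length * Real.exp (m * (xEnd w : ℝ))) :=
  Finset.sum_le_sum_of_subset_of_nonneg (fun w hw => by
    obtain ⟨hW, hirr⟩ := Finset.mem_filter.1 hw
    exact Finset.mem_filter.2 ⟨hW, hirr.bridge⟩) fun w _ _ => tiltWt_nonneg hz m w

/-- `H_N(z, L) ≤ χ_N(z)`. [folklore] -/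
theorem gfPos_le_gfAll {z : ℝ} (hz : 0 ≤ z) (N : ℕ) (L : ℤ) :
    (∑ w ∈ ((Finset.range (N + 1)).biUnion sawWords).filter
    (fun w => (∀ i, 1 ≤ i → i ≤ w.length → 0 < xAt w i) ∧ xEnd w = (L : ℤ)), z ^ w.length)
    ≤ (∑ w ∈ ((Finset.range (N + 1)).biUnion sawWords), z ^ w.length) :=
  Finset.sum_le_sum_of_subset_of_nonneg (Finset.filter_subset _ _) fun _ _ _ => pow_nonneg hz _

/-- `χ_N ≥ 0`. [folklore] -/
theorem gfAll_nonneg {z : ℝ} (hz : 0 ≤ z) (N : ℕ) :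
    0 ≤ (∑ w ∈ ((Finset.range (N + 1)).biUnion sawWords), z ^ w.length) :=
  Finset.sum_nonneg fun _ _ => pow_nonneg hz _

/-- `B_N ≥ 0`. [folklore] -/
theorem gfBr_nonneg {z : ℝ} (hz : 0 ≤ z) (N : ℕ) (m : ℝ) :
    0 ≤ (∑ w ∈ ((Finset.range (N + 1)).biUnion sawWords).filter (fun w => IsBridgeW w),
    z ^ w.length * Real.exp (m * (xEnd w : ℝ))) :=
  Finset.sum_nonneg fun w _ => tiltWt_nonneg hz m w

/-- `Φ_N` is monotone in `N`. [folklore] -/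
theorem gfIrr_mono_N {N N' : ℕ} (hN : N ≤ N') {z : ℝ} (hz : 0 ≤ z) (m : ℝ) :
    (∑ w ∈ ((Finset.range (N + 1)).biUnion sawWords).filter (fun w => IsIrrBridge w),
        z ^ w.length * Real.exp (m * (xEnd w : ℝ)))
        ≤ (∑ w ∈ ((Finset.range (N' + 1)).biUnion sawWords).filter (fun w => IsIrrBridge w),
        z ^ w.length * Real.exp (m * (xEnd w : ℝ))) :=
  Finset.sum_le_sum_of_subset_of_nonneg (Finset.filter_subset_filter _ (Wset_mono hN))
    fun w _ _ => tiltWt_nonneg hz m w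

/-- `B_N^{≥ L}` is monotone in `N`. [folklore] -/
theorem gfBrGe_mono_N {N N' : ℕ} (hN : N ≤ N') {z : ℝ} (hz : 0 ≤ z) (m : ℝ) (L : ℤ) :
    (∑ w ∈ ((Finset.range (N + 1)).biUnion sawWords).filter
        (fun w => IsBridgeW w ∧ (L : ℤ) ≤ xEnd w), z ^ w.length * Real.exp (m * (xEnd w : ℝ)))
        ≤ (∑ w ∈ ((Finset.range (N' + 1)).biUnion sawWords).filter
        (fun w => IsBridgeW w ∧ (L : ℤ) ≤ xEnd w), z ^ w.length * Real.exp (m * (xEnd w : ℝ))) :=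
  Finset.sum_le_sum_of_subset_of_nonneg (Finset.filter_subset_filter _ (Wset_mono hN))
    fun w _ _ => tiltWt_nonneg hz m w

/-- `H_N` is monotone in `N`. [folklore] -/
theorem gfPos_mono_N {N N' : ℕ} (hN : N ≤ N') {z : ℝ} (hz : 0 ≤ z) (L : ℤ) :
    (∑ w ∈ ((Finset.range (N + 1)).biUnion sawWords).filter
        (fun w => (∀ i, 1 ≤ i → i ≤ w.length → 0 < xAt w i) ∧ xEnd w = (L : ℤ)), z ^ w.length)
        ≤ (∑ w ∈ ((Finset.range (N' + 1)).biUnion sawWords).filter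
        (fun w => (∀ i, 1 ≤ i → i ≤ w.length → 0 < xAt w i) ∧ xEnd w = (L : ℤ)), z ^ w.length) :=
  Finset.sum_le_sum_of_subset_of_nonneg (Finset.filter_subset_filter _ (Wset_mono hN))
    fun _ _ _ => pow_nonneg hz _

/-- `Φ_{N'} - Φ_N` (`N ≤ N'`) is monotone in `z ≥ 0` (non-negative coefficients). [folklore] -/
theorem gfIrr_sub_mono {N N' : ℕ} (hN : N ≤ N') {z z' : ℝ} (hz : 0 ≤ z) (hzz' : z ≤ z') (m : ℝ) :
    (∑ w ∈ ((Finset.range (N' + 1)).biUnion sawWords).filter (fun w => IsIrrBridge w),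
        z ^ w.length * Real.exp (m * (xEnd w : ℝ)))
        - (∑ w ∈ ((Finset.range (N + 1)).biUnion sawWords).filter (fun w => IsIrrBridge w),
        z ^ w.length * Real.exp (m * (xEnd w : ℝ)))
        ≤ (∑ w ∈ ((Finset.range (N' + 1)).biUnion sawWords).filter (fun w => IsIrrBridge w),
        z' ^ w.length * Real.exp (m * (xEnd w : ℝ)))
        - (∑ w ∈ ((Finset.range (N + 1)).biUnion sawWords).filter (fun w => IsIrrBridge w),
        z' ^ w.length * Real.exp (m * (xEnd w : ℝ))) :=
  sub_sum_mono (Finset.filter_subset_filter _ (Wset_mono hN)) fun w => tiltWt_mono hz hzz' m w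

/-- `H_{N'} - H_N` (`N ≤ N'`) is monotone in `z ≥ 0`. [folklore] -/
theorem gfPos_sub_mono {N N' : ℕ} (hN : N ≤ N') {z z' : ℝ} (hz : 0 ≤ z) (hzz' : z ≤ z') (L : ℤ) :
    (∑ w ∈ ((Finset.range (N' + 1)).biUnion sawWords).filter
        (fun w => (∀ i, 1 ≤ i → i ≤ w.length → 0 < xAt w i) ∧ xEnd w = (L : ℤ)), z ^ w.length)
        - (∑ w ∈ ((Finset.range (N + 1)).biUnion sawWords).filter
        (fun w => (∀ i, 1 ≤ i → i ≤ w.length → 0 < xAt w i) ∧ xEnd w = (L : ℤ)), z ^ w.length)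
        ≤ (∑ w ∈ ((Finset.range (N' + 1)).biUnion sawWords).filter
        (fun w => (∀ i, 1 ≤ i → i ≤ w.length → 0 < xAt w i) ∧ xEnd w = (L : ℤ)), z' ^ w.length)
        - (∑ w ∈ ((Finset.range (N + 1)).biUnion sawWords).filter
        (fun w => (∀ i, 1 ≤ i → i ≤ w.length → 0 < xAt w i) ∧ xEnd w = (L : ℤ)), z' ^ w.length) :=
  sub_sum_mono (Finset.filter_subset_filter _ (Wset_mono hN)) fun _ => pow_le_pow_left₀ hz hzz' _

/-- `z ↦ Φ_N(z, m)` is continuous (a finite sum). [folklore] -/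
theorem continuous_gfIrr (N : ℕ) (m : ℝ) : Continuous fun z : ℝ =>
    (∑ w ∈ ((Finset.range (N + 1)).biUnion sawWords).filter (fun w => IsIrrBridge w),
    z ^ w.length * Real.exp (m * (xEnd w : ℝ))) :=
  continuous_finsetSum _ fun w _ => (continuous_pow w.length).mul continuous_const

/-- `z ↦ H_N(z, L)` is continuous (a polynomial). [folklore] -/
theorem continuous_gfPos (N : ℕ) (L : ℤ) : Continuous fun z : ℝ =>
    (∑ w ∈ ((Finset.range (N + 1)).biUnion sawWords).filter
    (fun w => (∀ i, 1 ≤ i → i ≤ w.length → 0 < xAt w i) ∧ xEnd w = (L : ℤ)), z ^ w.length) :=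
  continuous_finsetSum _ fun w _ => continuous_pow w.length

/-! ### Registered sub-goal of part I -/

/-- **Last-exit cut** (the registered sub-goal `kestenTilt_lastExitCut` of the crux item, part I of the
stub `stub_kestenTilt`; `exists_pos_append_bridge` restated in closed form): a bridge word whose span is
`≥ L ≥ 0` is a half-space word ending on the line `x = L` followed by a bridge.
[cite: MadrasSlade1993, §4.1, proof of (4.1.12)] -/
theorem kestenTilt_lastExitCut : ∀ (w : List Step) (L : ℤ), IsBridgeW w → 0 ≤ L → L ≤ xEnd w →
    ∃ u v : List Step, u ++ v = w ∧ (∀ i, 1 ≤ i → i ≤ u.length → 0 < xAt u i) ∧ xEnd u = L ∧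
      IsBridgeW v :=
  fun _ _ hb hL0 hL => exists_pos_append_bridge hb hL0 hL

end KestenTilt

end Summit.CriticalPhenomena.SAWScalingLimit.Theorems.TubeLowerBound.SubcriticalRenewalFloor
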